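/-
Copyright (c) 2026 the pub-hodgecm-mathlib formalisation cell (harness21).  R90-TF SLAB, section S10 (Rogawski 1990, §13.8 read at `v`),
prover R90-C138-p05 (g2) — block C of the A2a₂ telescope (census `R90/R90-C138-p05/g0/CENSUS-40b-thetaLineGlobal.md` d666bc68, RULINGS J-θ (β′), J-LC′, J-LC′-2):
the FINAL C-PAYER; h413 = `stmt-HodgeConjecture-24833`, route `HCCMUnconditional`.
-/
import Summits.HodgeConjecture.HodgeConjecture.Theorems.R90S10ThetaLineTracePin            -- ★ p864958 (LH7-p07, C-iii-3): `thetaLine_tracePin_of_char`; brings ★ R4′ `charLine_occurs_linked_multOne`, `smoothTrace_charClass_eq_integral`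
import Summits.HodgeConjecture.HodgeConjecture.Theorems.R90S10ThetaCharOfTorusCharExtend  -- ★ p864966 (p08, J-LC′-2 bridge): `exists_thetaChar_of_torusCharExtendLetter`, `exists_thetaChar_of_nonsplit`; brings ★ `torusCharExtendLetter_holds`
import HarnessLib

/-!
# R90-TF · S10 (Rogawski 1990 §13.8) · THEOREMS — `R90S10ThetaBlockCOfTorusCharExtend`: BLOCK C OF THE A2a₂ TELESCOPE, PAID — THE θ-LINE ON `U(Φ₁)` PINNED AT `v`,
# UNRAMIFIED OFF `v`, WITH ITS GLOBAL CLASS, ITS ARCHIMEDEAN COMPONENT AND THE GLOBAL TRACE PIN `hθi`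

Cell hodgecm-mathlib, slab R90-TF, section S10 = §13.8, crux item h413 = stmt-HodgeConjecture-24833 (route `route-HodgeConjecture-HCCMUnconditional`).
Prover seat R90-C138-p05 (g2) (successor of R90-C138-p05 (g0), whose census d666bc68 specified block C and found the (C-iv) obstruction «`θ` must be
unramified off `v`» that RULINGS J-θ (β′) ∕ J-LC′ ∕ J-LC′-2 resolved through the torus-extension letter L-C′).  CONSUMER: the letter `hC` of ★ p864804
`realiseH₂_of_letters` (`Theorems/R90S10RealiseH2OfLetters.lean` :191–:226) — A ED. 10∕11's C-slot `sock_S10_thetaBlockC`.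

WHAT.  Print [Rogawski1990, §13.8 Prop. 13.8.3 (proof), p. 218 L9–L10, p. 219 L1–L2]: «`ρ = ρ′ ⊠ θ` where `θ` is a character of `U(Φ₁)` such that `θ_v = χ`»
and «`Tr ρ(f^H) = Tr ρ′(f′) · ∫ θ …`» — block C of the `H`-datum is the `U(Φ₁)`-LINE: an automorphic character `θ = (⟦ℂ_{χθ_w}⟧)_w` of `U(Φ₁)(𝔸_{L⁺})` with
(C1) occurrence in the discrete spectrum, (C2) its classes are the character classes `⟦ℂ_{χθ_w}⟧`, (C3) the PIN `χθ_v = ψ_v ∘ det` (the `U(Φ₁)`-label of `πSt`),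
(C4) UNRAMIFIED OFF `v` (`χθ_w = 1` on `U(Φ₁)(𝒪_w)`), (C5)–(C6) the local trace at `v` is `∫ f χθ_v dν₁v`, (C7)–(C8) the global class `d₁` is linked to `θ` with
multiplicity one [Gelbart1975, Thm. 10.10], (C9) the GLOBAL TRACE PIN `hθi`: `Tr θ(g_∞ ⊗ g_v ⊗ 𝟙_{U(Φ₁)(𝒪^v)}) = m(θ) · ∫ g_∞ θ_∞ · Tr θ_v(g_v)` (Flath split on
`U(1)`, Tate's Euler factorisation), (C10)–(C11) `θ_∞` continuous against a Haar measure finite on compacta.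

PROOF = ASSEMBLY OF ★ BRICKS (no new mathematics in this file):
* the LINE `Θ` with local readings `θloc`, pinned at `v` and unramified off `v` — ★ p864966 `exists_thetaChar_of_torusCharExtendLetter` (p08's J-LC′-2 bridge) applied
  to the torus-extension letter L-C′ ★ `TorusCharExtendLetter L v` (p864883), itself ★-PAID by `torusCharExtendLetter_holds` (K2E5-p16, p864932: Weil's extension
  principle for the anisotropic norm-one torus, the obstruction `μ(L)` compensated at the archimedean exponents, ★ B3) — valid because `v` is NOT SPLIT in `L` (`hns`,
  print's ⟪P⟫);
* an automorphic measure `μ₁` on `U(Φ₁)(L⁺)\U(Φ₁)(𝔸_{L⁺})` — ★ `exists_isAutomorphicMeasure_H1` [Borel1963, Thm. 5.8]; a Haar measure `ν₁v` on `U(Φ₁)(L⁺_v)`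
  (★ instance `locallyCompactSpace_cmDatum_local`);
* (C1) (C7) (C8) — ★ R4′ `charLine_occurs_linked_multOne` (p864796); (C6) — ★ `smoothTrace_charClass_eq_integral` [Rogawski1990, Prop. 13.1.4 p. 199];
* (C3) — the bridge's pin `θloc v = χ₁(ξ)_v` + ★ `chiOneOfOneDim_eq_torusLocalComponent_comp_localDet` (junction token `ψ_v ∘ det`);
* (C9) (C10) (C11) + the Haar measures `ν₁`, `ν₁i` and `χi = Θ ∘ archToAdelic` — ★ `thetaLine_tracePin_of_char` (p864958, LH7-p07: ★ Euler brick p864900 §3 +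
  ★ bridge p864901 + ★ (F) p864835) at the STANDARD level family `K₁ w := U(Φ₁)(𝒪_w)` (so its `hK₁std` is `rfl`).

CONTENTS (theorems only; no `def`, no `instance`, no `notation`, no `sorry`; axioms ⊆ {propext, Classical.choice, Quot.sound}).
* §1 `thetaBlockC_of_thetaChar` — block C's body for a GIVEN line `(Θ, θloc)` with the J-θ pins `hθv`, `hθunr` (hypothesis-first; R4′ + C-iii-3 assembled).
* §2 `thetaBlockC_of_torusCharExtendLetter (hT : TorusCharExtendLetter L v) (ξ) (hns)` — block C's body from the torus letter (dealer spec DEAL #67, the shape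
  A ED. 10's C-slot callback `thetaBlockC_of_torusCharExtendLetter (sock_S10_torusCharExtend L v) …` consumes).
* §2 `thetaBlockC (ξ) (hns)` — block C's body UNCONDITIONALLY at non-split `v` (★ `torusCharExtendLetter_holds`).
* §3 `thetaBlockC_holds` — THE LETTER `hC` OF ★ `realiseH₂_of_letters` AS A CLOSED THEOREM: its binder type :191–:226 BYTE-FOR-BYTE (all of ⟪P⟫ ⟪U⟫ `h3` and the
  (13.8.3) frame at `v` as idle premises, exactly as the telescope quantifies them), so that A's edition passes the bare constant `thetaBlockC_holds` for `hC`.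
JUNCTION: §3's statement is the text of `R90S10RealiseH2OfLetters.lean` :191–:226 with `(hC : ` and the closing `)` removed — nothing else.

HONEST LABEL: block C is now ★-closed in house (this file + its ★ imports); it pays the C-slot of the A2a₂ telescope ONLY — the socket `sock_S10_realiseH₂` still
waits on letters E (S2∕S4), T2 (S2), A (EXT, Langlands L₁), B (E1), D's inputs and F (XL); HC_CM is proved only modulo the 7 printed citations (2 remaining named
inputs: hLiu418 = stmt-HodgeConjecture-24832, h413 = stmt-HodgeConjecture-24833) until rung 0 closes; count-neutral helper; REL ≠ ★ ≠ WRITTEN ≠ BUILT.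
Namespace `Summit.HodgeConjecture.HodgeConjecture.R90.S10`.

## References
* [Rogawski1990] J. D. Rogawski, *Automorphic Representations of Unitary Groups in Three Variables*, Ann. of Math. Stud. 123 (1990), §13.8 Prop. 13.8.3 (proof)
  p. 217 l. 9–12, p. 218 L9–L10, p. 219 L1–L2; §13.3 pp. 202–203; §13.1 Prop. 13.1.4 p. 199.
* [Gelbart1975] S. Gelbart, *Automorphic forms on adele groups*, Ann. of Math. Stud. 83 (1975), §2.A; Thm. 10.10.
* [Borel1963] A. Borel, *Some finiteness properties of adele groups over number fields*, Publ. Math. IHÉS 16 (1963), Thm. 5.8.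
* [Weil1956] A. Weil, *On a certain type of characters of the idèle-class group of an algebraic number-field* (1956), §1.
* [FlathCorvallis1979] D. Flath, *Decomposition of representations into tensor products*, PSPM 33.1 (1979), Thm. 3–4.
-/

set_option autoImplicit false
-- the mandated namespace repeats the single-problem summit's segment (`HodgeConjecture.HodgeConjecture`)
set_option linter.dupNamespace false

noncomputable section

open scoped RestrictedProduct Matrix MatrixGroups NNReal ENNReal
open Filter MeasureTheory NumberField IsDedekindDomain CompactlySupported Topology
open Literature.NumberTheory Literature.NumberTheory.Rogawski1990 Literature.NumberTheory.Automorphic Literature.NumberTheory.Automorphic.UnitaryGroup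
open Literature.NumberTheory.Automorphic.UnitaryGroup.CotangentForms Literature.NumberTheory.GaloisRepresentations
open Literature.NumberTheory.Automorphic.Arthur2013.Leaves.TECR
open Summit.HodgeConjecture.HodgeConjecture.Cruxes.H413
open Summit.HodgeConjecture.HodgeConjecture.Cruxes.H413.F0P3GlobalPacketDiscrete (cmOccursInDiscreteSpectrum)
open Summit.HodgeConjecture.HodgeConjecture.Cruxes.H413.K2E1TraceFormulaBeta
open Summit.HodgeConjecture.HodgeConjecture.Cruxes.H413.K2E1SpectralTermsDiscreteHalf

namespace Summit.HodgeConjecture.HodgeConjecture.R90.S10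

variable (L : Type) [Field L] [NumberField L] [IsCMField L]

/-! ## §1 Block C for a given line `(Θ, θloc)` pinned at `v` and unramified off `v` -/

/-- **BLOCK C FOR A GIVEN AUTOMORPHIC CHARACTER LINE.**  For an automorphic character `Θ` of `U(Φ₁)(𝔸_{L⁺})` with open-kernel local readings `θloc w`
(`hΘ : θloc w ∘ localPiEquiv w = Θ ∘ inclPlaceAdelic w`), PINNED at `v` to `ψ_v ∘ det` (`hθv : θloc v = χ₁(ξ)_v`) and UNRAMIFIED OFF `v` (`hθunr`): the twelve
witnesses and eleven conjuncts of letter `hC` of ★ `realiseH₂_of_letters` — `μ₁` automorphic (★ `exists_isAutomorphicMeasure_H1`), `θ w := ⟦ℂ_{θloc w}⟧`,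
`χθ := θloc`, `ν₁v := haar`, `χv := θloc v`, `d₁ := mk (ofChar Θ⁻¹ μ₁)` (★ R4′ `charLine_occurs_linked_multOne`: occurrence, linkage, multiplicity one), the local
trace formula (★ `smoothTrace_charClass_eq_integral`), and `ν₁ ν₁i χi` with the global trace pin `hθi`, `Continuous χi`, `IsFiniteMeasureOnCompacts ν₁i`
(★ `thetaLine_tracePin_of_char` at the standard levels `K₁ w := U(Φ₁)(𝒪_w)`).
[cite: Rogawski1990, §13.8 Prop. 13.8.3 (proof) p. 218 L9–L10, p. 219 L1–L2; §13.3 pp. 202–203; §13.1 Prop. 13.1.4 p. 199] [cite: Gelbart1975, Thm. 10.10]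
[cite: Borel1963, Thm. 5.8] -/
theorem thetaBlockC_of_thetaChar (v : Pl L)
    [MeasurableSpace (H1Loc L v)] [BorelSpace (H1Loc L v)] [MeasurableSpace (H1Arch L)] [BorelSpace (H1Arch L)]
    [MeasurableSpace (H1 L).Adelic] [BorelSpace (H1 L).Adelic]
    (ξ : OneDimAutRepH L) (Θ : (H1 L).AutomorphicCharacter) (θloc : ∀ w : Pl L, H1Loc L w →* ℂˣ)
    (hθo : ∀ w : Pl L, IsOpen ((((θloc w).ker : Subgroup (H1Loc L w))) : Set (H1Loc L w)))
    (hΘ : ∀ (w : Pl L) (u : localPi L (IsCMField.complexConj L) 1 (Matrix.of fun i j : Fin 1 => if i.val + j.val + 1 = 1 then (1 : L) else 0) w),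
      θloc w (localPiEquiv L (IsCMField.complexConj L) 1 (Matrix.of fun i j : Fin 1 => if i.val + j.val + 1 = 1 then (1 : L) else 0) w u) =
        Θ (inclPlaceAdelic (↥(maximalRealSubfield L)) L (IsCMField.complexConj L) 1 (Matrix.of fun i j : Fin 1 => if i.val + j.val + 1 = 1 then (1 : L) else 0) w u))
    (hθv : θloc v = R90.S5.chiOneOfOneDim ξ v)
    (hθunr : ∀ w : Pl L, w ≠ v → ∀ k ∈ cmLocalIntegralLevel L 1 (Matrix.of fun i j : Fin 1 => if i.val + j.val + 1 = 1 then (1 : L) else 0) w, θloc w k = 1) :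
    ∃ (μ₁ : Measure (H1 L).automorphicQuotient) (_ : (H1 L).IsAutomorphicMeasure μ₁) (θ : ∀ w : Pl L, IrrClass (H1Loc L w)) (χθ : ∀ w : Pl L, H1Loc L w →* ℂˣ) (hχθ : ∀ w : Pl L, IsOpen ((χθ w).ker : Set (H1Loc L w))) (ν₁v : Measure (H1Loc L v)) (χv : H1Loc L v → ℂ) (ν₁i : Measure (H1Arch L)) (χi : H1Arch L → ℂ) (ν₁ : Measure (H1 L).Adelic) (_ : ν₁.IsHaarMeasure) (d₁ : DiscreteClass (H1 L) μ₁),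
        cmOccursInDiscreteSpectrum L 1 (Matrix.of fun i j : Fin 1 => if i.val + j.val + 1 = 1 then (1 : L) else 0) μ₁ θ ∧
        (∀ w : Pl L, θ w = IrrClass.mk (SmoothIrrep.ofChar (χθ w) (hχθ w))) ∧
        (χθ v = (torusLocalComponent L (IsCMField.complexConj L) v ξ.ψ).comp (localDet (IsCMField.complexConj L) v (isUnit_antidiagOne_det L 1))) ∧
        (∀ w : Pl L, w ≠ v → ∀ k ∈ (cmLocalIntegralLevel L 1 (Matrix.of fun i j : Fin 1 => if i.val + j.val + 1 = 1 then (1 : L) else 0) w), χθ w k = 1) ∧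
        (χv = fun z => ((χθ v z : ℂˣ) : ℂ)) ∧
        (∀ f₁ : H1Loc L v → ℂ, IsLocSmooth f₁ → (θ v).smoothTrace ν₁v f₁ = ∫ z, f₁ z * χv z ∂ν₁v) ∧
        IsLinked L 1 (Matrix.of fun i j : Fin 1 => if i.val + j.val + 1 = 1 then (1 : L) else 0) μ₁ d₁ θ ∧
        d₁.mult = 1 ∧
        (∀ (gi : H1Arch L → ℂ) (gv : H1Loc L v → ℂ), ArchSmooth L 1 (Matrix.of fun i j : Fin 1 => if i.val + j.val + 1 = 1 then (1 : L) else 0) gi → IsLocSmooth gv →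
    ∀ (Φ₁ : (H1Loc L v → ℂ) → C_c((H1 L).Adelic, ℂ)),
      (∀ g₁ : H1Loc L v → ℂ, IsLocSmooth g₁ → ∀ z : (H1 L).Adelic,
        Φ₁ g₁ z = gi (UnitaryGroup.archPart (↥(maximalRealSubfield L)) L (IsCMField.complexConj L) 1
            (Matrix.of fun i j : Fin 1 => if i.val + j.val + 1 = 1 then (1 : L) else 0) z) *
          (g₁ ((H1 L).toLocal v z) *
            ∏ᶠ w : {w : Pl L // w ≠ v}, Set.indicator ((cmLocalIntegralLevel L 1 (Matrix.of fun i j : Fin 1 => if i.val + j.val + 1 = 1 then (1 : L) else 0) w.1) : Set (H1Loc L w.1)) (fun _ => (1 : ℂ)) ((H1 L).toLocal w.1 z))) →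
      d₁.classTrace ν₁ (Φ₁ gv) = ((d₁.mult).toNat : ℂ) * (∫ z, gi z * χi z ∂ν₁i) * (θ v).smoothTrace ν₁v gv) ∧
        Continuous χi ∧
        IsFiniteMeasureOnCompacts ν₁i := by
  classical
  -- an automorphic measure on `U(Φ₁)(L⁺)\U(Φ₁)(𝔸)` and a Haar measure on `U(Φ₁)(L⁺_v)`
  obtain ⟨μ₁, hμ₁⟩ := exists_isAutomorphicMeasure_H1 L
  haveI := hμ₁
  haveI : LocallyCompactSpace (H1Loc L v) :=
    locallyCompactSpace_cmDatum_local (L := L) (N := 1) (H := Matrix.of fun i j : Fin 1 => if i.val + j.val + 1 = 1 then (1 : L) else 0) (v := v)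
  let ν₁v : Measure (H1Loc L v) := Measure.haar
  -- (C1) (C7) (C8): occurrence, linkage, multiplicity one of the line `mk (ofChar Θ⁻¹ μ₁)` (★ R4′)
  obtain ⟨hocc, hlink, hmult⟩ := charLine_occurs_linked_multOne L μ₁ Θ θloc hθo hΘ
  -- (C9) (C10) (C11): the global trace pin at the standard levels, with its Haar measures `ν₁`, `ν₁i` and `χi = Θ ∘ archToAdelic` (★ C-iii-3)
  obtain ⟨ν₁, hν₁, ν₁i, hν₁i, χi, -, hcont, hfin, hθi⟩ := thetaLine_tracePin_of_char L v μ₁ ν₁v Θ θloc hθo hΘ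
    (fun w hw k hk => hθunr w hw k hk)
    (fun w => cmLocalIntegralLevel L 1 (Matrix.of fun i j : Fin 1 => if i.val + j.val + 1 = 1 then (1 : L) else 0) w) (fun _ _ => rfl)
  haveI := hν₁i
  refine ⟨μ₁, hμ₁, fun w : Pl L => (IrrClass.mk (SmoothIrrep.ofChar (θloc w) (hθo w)) : IrrClass (H1Loc L w)), θloc, hθo, ν₁v,
    fun z => ((θloc v z : ℂˣ) : ℂ), ν₁i, χi, ν₁, hν₁, DiscreteClass.mk (DiscreteAutomorphicRep.ofChar Θ⁻¹ μ₁),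
    hocc, fun _ => rfl, ?_, hθunr, rfl, fun f₁ hf => smoothTrace_charClass_eq_integral L v (θloc v) (hθo v) ν₁v f₁ hf, hlink, hmult, ?_, hcont, hfin⟩
  · -- (C3) the pin at `v`: `θloc v = χ₁(ξ)_v = ψ_v ∘ det`
    rw [hθv, chiOneOfOneDim_eq_torusLocalComponent_comp_localDet]
  · -- (C9) the trace pin, at `K₁ w := U(Φ₁)(𝒪_w)`
    intro gi gv hgi hgv Φ₁ hΦ
    exact hθi gi gv hgi hgv Φ₁ hΦ

/-! ## §2 Block C from the torus-extension letter L-C′, and unconditionally at non-split `v` -/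

/-- **BLOCK C FROM THE TORUS LETTER L-C′** (DEAL #67 shape): at a place `v` with `TorusCharExtendLetter L v` (★ p864883) and NOT split in `L` (`hns`), for every
one-dimensional automorphic `ξ` of `H`, the body of letter `hC` of ★ `realiseH₂_of_letters` holds — the line is ★ `exists_thetaChar_of_torusCharExtendLetter hT ξ hns`
(p08's bridge), then §1. [cite: Rogawski1990, §13.8 Prop. 13.8.3 (proof) p. 217 l. 9–12, p. 218 L9–L10, p. 219 L1–L2; §13.3 pp. 202–203] [cite: Weil1956, §1] -/
theorem thetaBlockC_of_torusCharExtendLetter (v : Pl L)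
    [MeasurableSpace (H1Loc L v)] [BorelSpace (H1Loc L v)] [MeasurableSpace (H1Arch L)] [BorelSpace (H1Arch L)]
    [MeasurableSpace (H1 L).Adelic] [BorelSpace (H1 L).Adelic]
    (hT : TorusCharExtendLetter L v) (ξ : OneDimAutRepH L) (hns : ∀ w : PlacesOver L v, IsCMField.complexConj L • w.1 = w.1) :
    ∃ (μ₁ : Measure (H1 L).automorphicQuotient) (_ : (H1 L).IsAutomorphicMeasure μ₁) (θ : ∀ w : Pl L, IrrClass (H1Loc L w)) (χθ : ∀ w : Pl L, H1Loc L w →* ℂˣ) (hχθ : ∀ w : Pl L, IsOpen ((χθ w).ker : Set (H1Loc L w))) (ν₁v : Measure (H1Loc L v)) (χv : H1Loc L v → ℂ) (ν₁i : Measure (H1Arch L)) (χi : H1Arch L → ℂ) (ν₁ : Measure (H1 L).Adelic) (_ : ν₁.IsHaarMeasure) (d₁ : DiscreteClass (H1 L) μ₁),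
        cmOccursInDiscreteSpectrum L 1 (Matrix.of fun i j : Fin 1 => if i.val + j.val + 1 = 1 then (1 : L) else 0) μ₁ θ ∧
        (∀ w : Pl L, θ w = IrrClass.mk (SmoothIrrep.ofChar (χθ w) (hχθ w))) ∧
        (χθ v = (torusLocalComponent L (IsCMField.complexConj L) v ξ.ψ).comp (localDet (IsCMField.complexConj L) v (isUnit_antidiagOne_det L 1))) ∧
        (∀ w : Pl L, w ≠ v → ∀ k ∈ (cmLocalIntegralLevel L 1 (Matrix.of fun i j : Fin 1 => if i.val + j.val + 1 = 1 then (1 : L) else 0) w), χθ w k = 1) ∧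
        (χv = fun z => ((χθ v z : ℂˣ) : ℂ)) ∧
        (∀ f₁ : H1Loc L v → ℂ, IsLocSmooth f₁ → (θ v).smoothTrace ν₁v f₁ = ∫ z, f₁ z * χv z ∂ν₁v) ∧
        IsLinked L 1 (Matrix.of fun i j : Fin 1 => if i.val + j.val + 1 = 1 then (1 : L) else 0) μ₁ d₁ θ ∧
        d₁.mult = 1 ∧
        (∀ (gi : H1Arch L → ℂ) (gv : H1Loc L v → ℂ), ArchSmooth L 1 (Matrix.of fun i j : Fin 1 => if i.val + j.val + 1 = 1 then (1 : L) else 0) gi → IsLocSmooth gv →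
    ∀ (Φ₁ : (H1Loc L v → ℂ) → C_c((H1 L).Adelic, ℂ)),
      (∀ g₁ : H1Loc L v → ℂ, IsLocSmooth g₁ → ∀ z : (H1 L).Adelic,
        Φ₁ g₁ z = gi (UnitaryGroup.archPart (↥(maximalRealSubfield L)) L (IsCMField.complexConj L) 1
            (Matrix.of fun i j : Fin 1 => if i.val + j.val + 1 = 1 then (1 : L) else 0) z) *
          (g₁ ((H1 L).toLocal v z) *
            ∏ᶠ w : {w : Pl L // w ≠ v}, Set.indicator ((cmLocalIntegralLevel L 1 (Matrix.of fun i j : Fin 1 => if i.val + j.val + 1 = 1 then (1 : L) else 0) w.1) : Set (H1Loc L w.1)) (fun _ => (1 : ℂ)) ((H1 L).toLocal w.1 z))) →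
      d₁.classTrace ν₁ (Φ₁ gv) = ((d₁.mult).toNat : ℂ) * (∫ z, gi z * χi z ∂ν₁i) * (θ v).smoothTrace ν₁v gv) ∧
        Continuous χi ∧
        IsFiniteMeasureOnCompacts ν₁i := by
  obtain ⟨Θ, θloc, hθo, hΘ, hθv, hθunr⟩ := exists_thetaChar_of_torusCharExtendLetter hT ξ hns
  exact thetaBlockC_of_thetaChar L v ξ Θ θloc hθo hΘ hθv hθunr

/-- **BLOCK C, UNCONDITIONALLY, AT A PLACE `v` NOT SPLIT IN `L`**: the torus letter is ★ `torusCharExtendLetter_holds L v` (K2E5-p16, p864932), so §2 applies outright.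
[cite: Rogawski1990, §13.8 Prop. 13.8.3 (proof) p. 217 l. 9–12, p. 218 L9–L10, p. 219 L1–L2] [cite: Weil1956, §1] -/
theorem thetaBlockC (v : Pl L)
    [MeasurableSpace (H1Loc L v)] [BorelSpace (H1Loc L v)] [MeasurableSpace (H1Arch L)] [BorelSpace (H1Arch L)]
    [MeasurableSpace (H1 L).Adelic] [BorelSpace (H1 L).Adelic]
    (ξ : OneDimAutRepH L) (hns : ∀ w : PlacesOver L v, IsCMField.complexConj L • w.1 = w.1) :
    ∃ (μ₁ : Measure (H1 L).automorphicQuotient) (_ : (H1 L).IsAutomorphicMeasure μ₁) (θ : ∀ w : Pl L, IrrClass (H1Loc L w)) (χθ : ∀ w : Pl L, H1Loc L w →* ℂˣ) (hχθ : ∀ w : Pl L, IsOpen ((χθ w).ker : Set (H1Loc L w))) (ν₁v : Measure (H1Loc L v)) (χv : H1Loc L v → ℂ) (ν₁i : Measure (H1Arch L)) (χi : H1Arch L → ℂ) (ν₁ : Measure (H1 L).Adelic) (_ : ν₁.IsHaarMeasure) (d₁ : DiscreteClass (H1 L) μ₁),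
        cmOccursInDiscreteSpectrum L 1 (Matrix.of fun i j : Fin 1 => if i.val + j.val + 1 = 1 then (1 : L) else 0) μ₁ θ ∧
        (∀ w : Pl L, θ w = IrrClass.mk (SmoothIrrep.ofChar (χθ w) (hχθ w))) ∧
        (χθ v = (torusLocalComponent L (IsCMField.complexConj L) v ξ.ψ).comp (localDet (IsCMField.complexConj L) v (isUnit_antidiagOne_det L 1))) ∧
        (∀ w : Pl L, w ≠ v → ∀ k ∈ (cmLocalIntegralLevel L 1 (Matrix.of fun i j : Fin 1 => if i.val + j.val + 1 = 1 then (1 : L) else 0) w), χθ w k = 1) ∧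
        (χv = fun z => ((χθ v z : ℂˣ) : ℂ)) ∧
        (∀ f₁ : H1Loc L v → ℂ, IsLocSmooth f₁ → (θ v).smoothTrace ν₁v f₁ = ∫ z, f₁ z * χv z ∂ν₁v) ∧
        IsLinked L 1 (Matrix.of fun i j : Fin 1 => if i.val + j.val + 1 = 1 then (1 : L) else 0) μ₁ d₁ θ ∧
        d₁.mult = 1 ∧
        (∀ (gi : H1Arch L → ℂ) (gv : H1Loc L v → ℂ), ArchSmooth L 1 (Matrix.of fun i j : Fin 1 => if i.val + j.val + 1 = 1 then (1 : L) else 0) gi → IsLocSmooth gv →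
    ∀ (Φ₁ : (H1Loc L v → ℂ) → C_c((H1 L).Adelic, ℂ)),
      (∀ g₁ : H1Loc L v → ℂ, IsLocSmooth g₁ → ∀ z : (H1 L).Adelic,
        Φ₁ g₁ z = gi (UnitaryGroup.archPart (↥(maximalRealSubfield L)) L (IsCMField.complexConj L) 1
            (Matrix.of fun i j : Fin 1 => if i.val + j.val + 1 = 1 then (1 : L) else 0) z) *
          (g₁ ((H1 L).toLocal v z) *
            ∏ᶠ w : {w : Pl L // w ≠ v}, Set.indicator ((cmLocalIntegralLevel L 1 (Matrix.of fun i j : Fin 1 => if i.val + j.val + 1 = 1 then (1 : L) else 0) w.1) : Set (H1Loc L w.1)) (fun _ => (1 : ℂ)) ((H1 L).toLocal w.1 z))) →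
      d₁.classTrace ν₁ (Φ₁ gv) = ((d₁.mult).toNat : ℂ) * (∫ z, gi z * χi z ∂ν₁i) * (θ v).smoothTrace ν₁v gv) ∧
        Continuous χi ∧
        IsFiniteMeasureOnCompacts ν₁i :=
  thetaBlockC_of_torusCharExtendLetter L v (torusCharExtendLetter_holds L v) ξ hns

/-! ## §3 Letter `hC` of ★ `realiseH₂_of_letters` as a closed theorem (its binder type :191–:226 byte-for-byte) -/

/-- **LETTER `hC` OF THE A2a₂ TELESCOPE, CLOSED**: the binder type of `hC` in ★ `realiseH₂_of_letters` (`Theorems/R90S10RealiseH2OfLetters.lean` :191–:226) token for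
token — universally quantified over ⟪P⟫ (`hv hμu hμω`), ⟪U⟫ (`hunr`), `h3` and the whole (13.8.3) frame at `v` (`νHv νQv mHv mQv πSt`, the Borel structures), all IDLE
for block C except `L`, `v`, `ξ`, the non-split premise and the `U(Φ₁)`-carriers' structures — proved by §2 `thetaBlockC`.  A's edition passes this bare constant for `hC`.
[cite: Rogawski1990, §13.8 Prop. 13.8.3 (proof) p. 217 l. 9–12, p. 218 L9–L10, p. 219 L1–L2; §13.3 pp. 202–203] [cite: Gelbart1975, Thm. 10.10] [cite: Weil1956, §1] -/
theorem thetaBlockC_holds : ∀ (L : Type) [Field L] [NumberField L] [IsCMField L] [DecidableEq (Pl L)] (μ : HeckeCharacter L) (v : Pl L)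
      [MeasurableSpace (HLoc L v)] [BorelSpace (HLoc L v)] [MeasurableSpace (Gqs L v)] [BorelSpace (Gqs L v)]
      (νHv : Measure (HLoc L v)) (νQv : Measure (Gqs L v)) [νHv.IsHaarMeasure] [νHv.IsMulRightInvariant] [νQv.IsHaarMeasure] [νQv.IsMulRightInvariant]
      [∀ a : HLoc L v, MeasurableSpace (HLoc L v ⧸ Subgroup.centralizer ({a} : Set (HLoc L v)))]
      [∀ a : HLoc L v, BorelSpace (HLoc L v ⧸ Subgroup.centralizer ({a} : Set (HLoc L v)))]
      [∀ γ : Gqs L v, MeasurableSpace (Gqs L v ⧸ Subgroup.centralizer ({γ} : Set (Gqs L v)))]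
      [∀ γ : Gqs L v, BorelSpace (Gqs L v ⧸ Subgroup.centralizer ({γ} : Set (Gqs L v)))]
      (mHv : OrbitalMeasureFamily (HLoc L v)) (mQv : OrbitalMeasureFamily (Gqs L v)) (πSt : IrrClass (HLoc L v))
      [MeasurableSpace (G3 L).Adelic] [BorelSpace (G3 L).Adelic] [MeasurableSpace (H2 L).Adelic] [BorelSpace (H2 L).Adelic]
      [MeasurableSpace (GArch L)] [BorelSpace (GArch L)] [MeasurableSpace (HArch L)] [BorelSpace (HArch L)]
      [MeasurableSpace (H1Loc L v)] [BorelSpace (H1Loc L v)] [MeasurableSpace (H1Arch L)] [BorelSpace (H1Arch L)]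
      [MeasurableSpace (H1 L).Adelic] [BorelSpace (H1 L).Adelic] (ξ : OneDimAutRepH L),
      (∀ w : PlacesOver L v, IsCMField.complexConj L • w.1 = w.1) → μ.IsUnitary →
      (∀ x : Literature.NumberTheory.GaloisRepresentations.ideleGroup ↥(maximalRealSubfield L),
        μ (AdeleRing.ideleBaseChange (↥(maximalRealSubfield L)) L x) = quadraticHeckeCharCM L x) →
      (∀ w : Pl L, w ≠ v → ∀ W : PlacesOver L w, Algebra.IsUnramifiedAt (𝓞 ↥(maximalRealSubfield L)) W.1.asIdeal ∧ μ.IsUnramifiedAt W.1) →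
      (3 ≤ Module.finrank ℚ ↥(maximalRealSubfield L)) →
      ∃ (μ₁ : Measure (H1 L).automorphicQuotient) (_ : (H1 L).IsAutomorphicMeasure μ₁) (θ : ∀ w : Pl L, IrrClass (H1Loc L w)) (χθ : ∀ w : Pl L, H1Loc L w →* ℂˣ) (hχθ : ∀ w : Pl L, IsOpen ((χθ w).ker : Set (H1Loc L w))) (ν₁v : Measure (H1Loc L v)) (χv : H1Loc L v → ℂ) (ν₁i : Measure (H1Arch L)) (χi : H1Arch L → ℂ) (ν₁ : Measure (H1 L).Adelic) (_ : ν₁.IsHaarMeasure) (d₁ : DiscreteClass (H1 L) μ₁),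
        cmOccursInDiscreteSpectrum L 1 (Matrix.of fun i j : Fin 1 => if i.val + j.val + 1 = 1 then (1 : L) else 0) μ₁ θ ∧
        (∀ w : Pl L, θ w = IrrClass.mk (SmoothIrrep.ofChar (χθ w) (hχθ w))) ∧
        (χθ v = (torusLocalComponent L (IsCMField.complexConj L) v ξ.ψ).comp (localDet (IsCMField.complexConj L) v (isUnit_antidiagOne_det L 1))) ∧
        (∀ w : Pl L, w ≠ v → ∀ k ∈ (cmLocalIntegralLevel L 1 (Matrix.of fun i j : Fin 1 => if i.val + j.val + 1 = 1 then (1 : L) else 0) w), χθ w k = 1) ∧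
        (χv = fun z => ((χθ v z : ℂˣ) : ℂ)) ∧
        (∀ f₁ : H1Loc L v → ℂ, IsLocSmooth f₁ → (θ v).smoothTrace ν₁v f₁ = ∫ z, f₁ z * χv z ∂ν₁v) ∧
        IsLinked L 1 (Matrix.of fun i j : Fin 1 => if i.val + j.val + 1 = 1 then (1 : L) else 0) μ₁ d₁ θ ∧
        d₁.mult = 1 ∧
        (∀ (gi : H1Arch L → ℂ) (gv : H1Loc L v → ℂ), ArchSmooth L 1 (Matrix.of fun i j : Fin 1 => if i.val + j.val + 1 = 1 then (1 : L) else 0) gi → IsLocSmooth gv →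
    ∀ (Φ₁ : (H1Loc L v → ℂ) → C_c((H1 L).Adelic, ℂ)),
      (∀ g₁ : H1Loc L v → ℂ, IsLocSmooth g₁ → ∀ z : (H1 L).Adelic,
        Φ₁ g₁ z = gi (UnitaryGroup.archPart (↥(maximalRealSubfield L)) L (IsCMField.complexConj L) 1
            (Matrix.of fun i j : Fin 1 => if i.val + j.val + 1 = 1 then (1 : L) else 0) z) *
          (g₁ ((H1 L).toLocal v z) *
            ∏ᶠ w : {w : Pl L // w ≠ v}, Set.indicator ((cmLocalIntegralLevel L 1 (Matrix.of fun i j : Fin 1 => if i.val + j.val + 1 = 1 then (1 : L) else 0) w.1) : Set (H1Loc L w.1)) (fun _ => (1 : ℂ)) ((H1 L).toLocal w.1 z))) →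
      d₁.classTrace ν₁ (Φ₁ gv) = ((d₁.mult).toNat : ℂ) * (∫ z, gi z * χi z ∂ν₁i) * (θ v).smoothTrace ν₁v gv) ∧
        Continuous χi ∧
        IsFiniteMeasureOnCompacts ν₁i := by
  intro L _ _ _ _ _ v _ _ _ _ _ _ _ _ _ _ _ _ _ _ _ _ _ _ _ _ _ _ _ _ _ _ _ _ _ _ _ ξ hns _ _ _ _
  exact thetaBlockC L v ξ hns

end Summit.HodgeConjecture.HodgeConjecture.R90.S10

end
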